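import Summits.NavierStokesRegularity.NavierStokesRegularity.Theorems.TerminalTraceTypeITraceScarL3NoConcentration
import Literature.Analysis.FluidPDE.NSViscosityRescaling
import Literature.Analysis.FluidPDE.NSLerayHopfABCScaling

set_option linter.dupNamespace false

/-!
# NO LOCAL `L²` CONCENTRATION AT A TYPE-I BLOW-UP TIME — every viscosity, `Tendsto` form
# (item `TerminalTrace.TypeITraceScarL3`, stmt-NavierStokesRegularity-18385; nsreg-p2 ROUND-33 seed s33-3)

Transport of `localEnergy_sub_top_le_unit` (`…NoConcentration.lean`) to viscosity `ν > 0` by Tao's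
normalisation `v(s,x) = ν⁻¹u(s/ν,x)` (classical at viscosity `1` on `[0,νT)`, Leray–Hopf, Type I in time at
`νT`; `∫_B |v(νt) − v(νT)|² = ν⁻² ∫_B |u(t) − u(T)|²`), and the headline statement:

* `localEnergy_sub_top_le` — for `(u,p)` classical on `[0,T)` with viscosity `ν`, Leray–Hopf on `[0,T]`,
  Type I in time at `T`: `∀ x₀ R θ>0 ∃ t₀<T ∀ t ∈ (t₀,T), ∫_{B(x₀,R)} |u(t) − u(T)|² ≤ θ`;
* `tendsto_localEnergy_sub_top` — `∫_{B(x₀,R)} |u(t) − u(T)|² → 0` as `t → T⁻`: **a Type-I (in time)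
  blow-up does not concentrate `L²` energy anywhere, singular points included** — the terminal profile
  `u(T)` is the STRONG `L²_loc` limit of the flow.  Known in substance in a stronger GLOBAL form:
  Leslie–Shvydkoy, ARMA 230 (2018), Thm. 1.2 (= arXiv:1705.04420) — Type I in time ⇒ energy equality on
  the closed interval including the blow-up time ⇒ `u(t) → u(T)` in `L²(ℝ³)` [cite: LeslieShvydkoy2017, Thm. 1.2];
  the tree proof is a different (local, CKN-slice) route (DIRECTOR-NS #189 (1): known result, new formal route).

For the item: at a point `x₀` of its open core (backward singular, `u(T) ∈ L³(B(x₀,ρ))`, Type I) the local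
energy `∫_{B(x₀,r)}|u(t)|²` converges, as `t → T⁻`, to `∫_{B(x₀,r)}|u(T)|² ≤ |B₁|^{1/3} r ‖u(T)‖²_{L³(B(x₀,r))} = o(r)`:
no energy is trapped at the scar.  (ROUND-33's terminal-layer dial `X(σ)` is NOT decided by this — the
limits `λ → 0` and `t → T` do not commute.)

WHAT THIS IS NOT: not 18385, not a Type-I exclusion, NOT Navier–Stokes regularity.
-/

noncomputable section

open MeasureTheory Set Function Metric Filter Topology Literature.Analysis.FluidPDE
open scoped ENNReal NNReal

namespace Summit.NavierStokesRegularity.NavierStokesRegularity.Theorems.TypeITraceScarL3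

/-- **No local `L²` concentration at a Type-I blow-up time, every viscosity** (module docstring):
`(u,p)` classical on `[0,T)` with viscosity `ν > 0`, Leray–Hopf on `[0,T]`, Type I in time at `T` ⇒ for
every `x₀`, `R` and `θ > 0` there is `t₀ < T` with `∫_{B(x₀,R)} |u(t) − u(T)|² ≤ θ` for `t ∈ (t₀,T)`.
[cite: Tao2011, footnote 3; CaffarelliKohnNirenberg1982, Thm B; AlbrittonBarker2019, Lemma 2.5] -/
theorem localEnergy_sub_top_le {ν T : ℝ} (hν : 0 < ν) (hT : 0 < T)
    {u : ℝ → EuclideanSpace ℝ (Fin 3) → EuclideanSpace ℝ (Fin 3)}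
    {p : ℝ → EuclideanSpace ℝ (Fin 3) → ℝ}
    (hcl : IsClassicalNSSolutionOn (Set.Ico 0 T) ν 0 u p) (hLH : IsLerayHopfOn T ν 0 (u 0) u)
    (hTI : IsTypeIBlowup u T) (x₀ : EuclideanSpace ℝ (Fin 3)) (R : ℝ) {θ : ℝ} (hθ : 0 < θ) :
    ∃ t₀ : ℝ, t₀ < T ∧ ∀ t ∈ Ioo t₀ T,
      ∫⁻ z in ball x₀ R, ‖u t z - u T z‖ₑ ^ 2 ≤ ENNReal.ofReal θ := by
  have hν0 : ν ≠ 0 := hν.ne'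
  have hνi : 0 < ν⁻¹ := inv_pos.2 hν
  have hνT : 0 < ν * T := mul_pos hν hT
  -- viscosity normalisation `v(s, x) = ν⁻¹ u(s/ν, x)`, blow-up time `νT`
  set v : ℝ → EuclideanSpace ℝ (Fin 3) → EuclideanSpace ℝ (Fin 3) := timeRescale ν⁻¹ ν⁻¹ u with hv
  set pv : ℝ → EuclideanSpace ℝ (Fin 3) → ℝ := timeRescale ν⁻¹ (ν⁻¹ ^ 2) p with hpv
  have hmaps : MapsTo (fun s => ν⁻¹ * s) (Ico 0 (ν * T)) (Ico 0 T) := by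
    intro s hs
    refine ⟨mul_nonneg hνi.le hs.1, ?_⟩
    calc ν⁻¹ * s < ν⁻¹ * (ν * T) := mul_lt_mul_of_pos_left hs.2 hνi
      _ = T := by rw [← mul_assoc, inv_mul_cancel₀ hν0, one_mul]
  have hclv : IsClassicalNSSolutionOn (Ico 0 (ν * T)) 1 0 v pv := by
    have h := hcl.viscosityRescale_set hν0 hmaps (uniqueDiffOn_Ico 0 (ν * T))
    rwa [timeRescale_zero_force] at h
  have hv0 : ν⁻¹ • u 0 = v 0 := by
    funext x
    simp [hv]
  have hLHv : IsLerayHopfOn (ν * T) 1 0 (v 0) v := by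
    have h := hLH.viscosityRescale hνi
    have e1 : T / ν⁻¹ = ν * T := by rw [div_inv_eq_mul, mul_comm]
    rwa [e1, inv_mul_cancel₀ hν0, timeRescale_zero_force, hv0] at h
  have hTIv : IsTypeIBlowup v (ν * T) := by
    -- Type I in time is preserved by the viscosity normalisation (constant `C/√ν`); inlined, the
    -- standalone statement lives in `…SelfMixingDichotomyCoherentScaleExclusionNoTypeII` (other cone)
    rw [hv]
    obtain ⟨C, hrateT⟩ := hTI
    have hν0 : ν ≠ 0 := hν.ne'
    have hνi : 0 < ν⁻¹ := inv_pos.2 hν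
    have e0 : ν⁻¹ * (ν * T) = T := by rw [← mul_assoc, inv_mul_cancel₀ hν0, one_mul]
    have htend : Tendsto (fun s : ℝ => ν⁻¹ * s) (𝓝[<] (ν * T)) (𝓝[<] T) := by
      refine tendsto_nhdsWithin_of_tendsto_nhds_of_eventually_within _ ?_ ?_
      · have h := ((continuous_const_mul ν⁻¹).tendsto (ν * T)).mono_left
          (nhdsWithin_le_nhds (s := Iio (ν * T)))
        rwa [e0] at h
      · refine eventually_nhdsWithin_of_forall fun s hs => ?_
        have h := mul_lt_mul_of_pos_left (mem_Iio.1 hs) hνi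
        rwa [e0] at h
    refine ⟨C / Real.sqrt ν, ?_⟩
    filter_upwards [htend.eventually hrateT, self_mem_nhdsWithin] with s hs hsT x
    have hsT' : s < ν * T := hsT
    have hpos : 0 < ν * T - s := sub_pos.2 hsT'
    have e : T - ν⁻¹ * s = ν⁻¹ * (ν * T - s) := by field_simp
    have hsq : Real.sqrt (T - ν⁻¹ * s) = (Real.sqrt ν)⁻¹ * Real.sqrt (ν * T - s) := by
      rw [e, Real.sqrt_mul hνi.le, Real.sqrt_inv]
    have hb' := hs x
    rw [hsq] at hb'
    have hsν : 0 < Real.sqrt ν := Real.sqrt_pos.2 hν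
    have hsνsq : Real.sqrt ν * Real.sqrt ν = ν := Real.mul_self_sqrt hν.le
    have hsqpos : 0 < Real.sqrt (ν * T - s) := Real.sqrt_pos.2 hpos
    rw [le_div_iff₀ (by positivity)] at hb'
    have hνinv : ν⁻¹ = (Real.sqrt ν)⁻¹ * (Real.sqrt ν)⁻¹ := by rw [← mul_inv, hsνsq]
    have key : ν⁻¹ * ‖u (ν⁻¹ * s) x‖ ≤ C / Real.sqrt ν / Real.sqrt (ν * T - s) := by
      rw [le_div_iff₀ hsqpos]
      calc ν⁻¹ * ‖u (ν⁻¹ * s) x‖ * Real.sqrt (ν * T - s)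
          = (Real.sqrt ν)⁻¹ * (‖u (ν⁻¹ * s) x‖ * ((Real.sqrt ν)⁻¹ * Real.sqrt (ν * T - s))) := by
              rw [hνinv]; ring
        _ ≤ (Real.sqrt ν)⁻¹ * C := mul_le_mul_of_nonneg_left hb' (inv_nonneg.2 hsν.le)
        _ = C / Real.sqrt ν := by rw [div_eq_inv_mul]
    rw [timeRescale_apply, norm_smul, Real.norm_eq_abs, abs_of_pos hνi]
    exact key
  -- the unit theorem for `v` at time `νT` with tolerance `ν⁻² θ`
  have hθ' : 0 < ν⁻¹ ^ 2 * θ := by positivity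
  obtain ⟨s₀, hs₀, hunit⟩ := localEnergy_sub_top_le_unit hνT hclv hLHv hTIv x₀ R hθ'
  have e0 : ν⁻¹ * (ν * T) = T := by rw [← mul_assoc, inv_mul_cancel₀ hν0, one_mul]
  refine ⟨ν⁻¹ * s₀, by nlinarith, fun t ht => ?_⟩
  -- `s = νt ∈ (s₀, νT)`
  have hs : ν * t ∈ Ioo s₀ (ν * T) := by
    constructor
    · have h := mul_lt_mul_of_pos_left ht.1 hν
      rwa [← mul_assoc, mul_inv_cancel₀ hν0, one_mul] at h
    · exact mul_lt_mul_of_pos_left ht.2 hν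
  have key := hunit (ν * t) hs
  -- `v(νt) − v(νT) = ν⁻¹ (u(t) − u(T))`
  have e1 : (fun z => ‖v (ν * t) z - v (ν * T) z‖ₑ ^ 2) =
      fun z => ‖ν⁻¹ • (u t z - u T z)‖ₑ ^ 2 := by
    funext z
    rw [hv, timeRescale_apply, timeRescale_apply, ← mul_assoc, inv_mul_cancel₀ hν0, one_mul, e0,
      smul_sub]
  rw [e1, lintegral_enorm_sq_const_smul, ENNReal.ofReal_mul (sq_nonneg _)] at key
  have hne0 : ENNReal.ofReal (ν⁻¹ ^ 2) ≠ 0 := by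
    rw [ne_eq, ENNReal.ofReal_eq_zero, not_le]; positivity
  exact (ENNReal.mul_le_mul_iff_right hne0 ENNReal.ofReal_ne_top).1 key

/-- **A TYPE-I (IN TIME) BLOW-UP DOES NOT CONCENTRATE `L²` ENERGY** — `Tendsto` form of
`localEnergy_sub_top_le`: for `(u,p)` classical on `[0,T)` with viscosity `ν > 0`, Leray–Hopf on `[0,T]`
and Type I in time at `T`, `∫_{B(x₀,R)} |u(t) − u(T)|² → 0` as `t → T⁻`, for EVERY centre `x₀` (singular
points included) and radius `R`.  nsreg-p2 ROUND-33 seed s33-3; known in substance in global form —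
cf. Leslie–Shvydkoy 2018, Thm. 1.2 (energy equality including the Type-I blow-up time); the tree proof
is CKN–Morrey–Federer at the top slice plus the regular-point convergence, not the energy equality.
[cite: LeslieShvydkoy2017, Thm. 1.2; CaffarelliKohnNirenberg1982, Thm B; AlbrittonBarker2019, Lemma 2.5; Federer1969, 2.10.2; Tao2011, Lemma 4.1 (i)] -/
theorem tendsto_localEnergy_sub_top {ν T : ℝ} (hν : 0 < ν) (hT : 0 < T)
    {u : ℝ → EuclideanSpace ℝ (Fin 3) → EuclideanSpace ℝ (Fin 3)}
    {p : ℝ → EuclideanSpace ℝ (Fin 3) → ℝ}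
    (hcl : IsClassicalNSSolutionOn (Set.Ico 0 T) ν 0 u p) (hLH : IsLerayHopfOn T ν 0 (u 0) u)
    (hTI : IsTypeIBlowup u T) (x₀ : EuclideanSpace ℝ (Fin 3)) (R : ℝ) :
    Tendsto (fun t => ∫⁻ z in ball x₀ R, ‖u t z - u T z‖ₑ ^ 2) (𝓝[<] T) (𝓝 0) := by
  rw [ENNReal.tendsto_nhds_zero]
  intro ε hε
  rcases eq_or_ne ε ⊤ with rfl | hεtop
  · exact Eventually.of_forall fun _ => le_top
  obtain ⟨t₀, ht₀, h⟩ := localEnergy_sub_top_le hν hT hcl hLH hTI x₀ R (ENNReal.toReal_pos hε.ne' hεtop)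
  rw [← nhdsWithin_Ioo_eq_nhdsLT ht₀]
  filter_upwards [self_mem_nhdsWithin] with t ht
  exact (h t ht).trans (ENNReal.ofReal_toReal hεtop).le

end Summit.NavierStokesRegularity.NavierStokesRegularity.Theorems.TypeITraceScarL3

end
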